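import Mathlib
import Summits.ValiantsHypothesis.ValiantsHypothesis.Theses.DivisionGap

/-!
# Crux-triage r1/k3 — Lean checks on the First-lemma / Transfer signatures of the idea cards
for crux `ShadowBirkhoff` (stmt-ValiantsHypothesis-5069).

The definitions below are copied VERBATIM from the ideators' published sketches
(`Cruxes/ShadowBirkhoff/Sketch-ideator1.lean`, `Sketch-ideator2.lean`, `SketchIdeator3.lean`);
the theorems record three cheap findings:

1. `counterFace_hyp_false` — the hypothesis `∀ m ≥ 1, CounterFace m (m^d)` of
   `shadowBirkhoff_of_counterFace` (card parabola-register-face) is unsatisfiable for every `d`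
   (at `m = 1`, `DS_1` has one vertex), so that transfer lemma is vacuous as typed.
2. `not_dominoShadow` — the transfer target `DominoShadow` (card polytrope-kr-planar-dimers) is
   FALSE as typed: it quantifies over all large `m`, and for odd `m` the `m × m` board has no domino
   tiling (`dominoPoints m = ∅`, no fixed-point-free involution on a set of odd size).
3. `gridDimerShadow_trivial` — the transfer target `GridDimerShadow` (card planar-transport-transfer)
   is TRIVIALLY TRUE as typed: the family `ρs` is not required to be injective, so one brick tiling
   repeated `m` times, with weight `0` on its cells and `1` elsewhere, satisfies it; hence
   `shadowBirkhoff_of_gridDimerShadow : GridDimerShadow → ShadowBirkhoff` is the crux itself.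
-/

noncomputable section

namespace TriageR1K3

open scoped BigOperators

/-! ## 1. parabola-register-face: `CounterFace m (m^d)` fails at `m = 1` -/

/-- Verbatim from `Sketch-ideator1.lean`. -/
def CounterFace (m N : ℕ) : Prop :=
  ∃ (G : Set (Fin N × Fin N)) (wa wb : Fin N × Fin N → ℝ),
    (∀ ρ : Equiv.Perm (Fin N), (∀ j, (ρ j, j) ∈ G) →
        (∑ j, wb (ρ j, j)) ^ 2 ≤ ∑ j, wa (ρ j, j)) ∧
    2 ^ m ≤ {t : ℝ | ∃ ρ : Equiv.Perm (Fin N), (∀ j, (ρ j, j) ∈ G) ∧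
        ∑ j, wb (ρ j, j) = t ∧ ∑ j, wa (ρ j, j) = t ^ 2}.ncard

theorem not_counterFace_one_one : ¬ CounterFace 1 1 := by
  rintro ⟨G, wa, wb, -, h⟩
  have hsub : {t : ℝ | ∃ ρ : Equiv.Perm (Fin 1), (∀ j, (ρ j, j) ∈ G) ∧
        ∑ j, wb (ρ j, j) = t ∧ ∑ j, wa (ρ j, j) = t ^ 2} ⊆
      {∑ j, wb ((1 : Equiv.Perm (Fin 1)) j, j)} := by
    rintro t ⟨ρ, -, hb, -⟩
    rw [Set.mem_singleton_iff, ← hb, Subsingleton.elim ρ 1]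
  have h1 := (Set.ncard_le_ncard hsub (Set.finite_singleton _)).trans_eq (Set.ncard_singleton _)
  omega

/-- The hypothesis of `Ideator1.shadowBirkhoff_of_counterFace` is unsatisfiable for every `d`:
that transfer lemma is vacuously true as typed (repair: `N = (m+1)^d`, or `∀ m ≥ m₀`). -/
theorem counterFace_hyp_false (d : ℕ) : ¬ ∀ m : ℕ, 1 ≤ m → CounterFace m (m ^ d) := fun h =>
  not_counterFace_one_one (by simpa using h 1 le_rfl)

/-! ## 2. polytrope-kr-planar-dimers: `DominoShadow` is false (odd boards) -/

/-- Verbatim from `Sketch-ideator2.lean`. -/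
def IsGridAdjacent {m : ℕ} (v w : Fin m × Fin m) : Prop :=
  (((v.1 : ℕ) + 1 = w.1 ∧ v.2 = w.2) ∨ ((w.1 : ℕ) + 1 = v.1 ∧ v.2 = w.2) ∨
    (v.1 = w.1 ∧ (v.2 : ℕ) + 1 = w.2) ∨ (v.1 = w.1 ∧ (w.2 : ℕ) + 1 = v.2))

/-- Verbatim from `Sketch-ideator2.lean`. -/
def dominoPoints (m : ℕ) : Set ((Fin m × Fin m) × (Fin m × Fin m) → ℝ) :=
  {x | ∃ f : Fin m × Fin m → Fin m × Fin m,
    (∀ v, f (f v) = v ∧ f v ≠ v ∧ IsGridAdjacent v (f v)) ∧ x = fun e => if f e.1 = e.2 then 1 else 0}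

/-- Verbatim from `Sketch-ideator2.lean`. -/
def DominoShadow : Prop :=
  ∀ c : ℕ, ∃ m₀ : ℕ, ∀ m ≥ m₀,
    ∃ L : (((Fin m × Fin m) × (Fin m × Fin m)) → ℝ) →ₗ[ℝ] (Fin 2 → ℝ),
      2 ^ ((Nat.log 2 m + c) ^ c) < (Set.extremePoints ℝ (convexHull ℝ (L '' dominoPoints m))).ncard

/-- A fixed-point-free involution forces even cardinality. -/
theorem two_dvd_card_of_fpf_involution {α : Type*} [Fintype α] [DecidableEq α] (f : α → α)
    (hf : ∀ v, f (f v) = v ∧ f v ≠ v) : 2 ∣ Fintype.card α := by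
  have hinv : Function.Involutive f := fun v => (hf v).1
  set σ : Equiv.Perm α := hinv.toPerm f with hσ
  have h2 : σ ^ 2 ^ 1 = 1 := by
    ext x
    simp [σ, pow_succ, Equiv.Perm.mul_apply, hinv x]
  haveI : Fact (Nat.Prime 2) := ⟨Nat.prime_two⟩
  have hmod := Equiv.Perm.card_compl_support_modEq h2
  have hsupp : σ.supportᶜ = ∅ := by
    ext x
    simp [Equiv.Perm.mem_support, σ, (hf x).2]
  rw [hsupp, Finset.card_empty] at hmod
  exact Nat.modEq_zero_iff_dvd.mp hmod.symm

theorem dominoPoints_eq_empty_of_odd {m : ℕ} (hm : Odd m) : dominoPoints m = ∅ := by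
  ext x
  simp only [dominoPoints, Set.mem_setOf_eq, Set.mem_empty_iff_false, iff_false]
  rintro ⟨f, hf, -⟩
  have h2 := two_dvd_card_of_fpf_involution f (fun v => ⟨(hf v).1, (hf v).2.1⟩)
  rw [Fintype.card_prod, Fintype.card_fin] at h2
  have hodd : Odd (m * m) := hm.mul hm
  exact (Nat.not_even_iff_odd.mpr hodd) (even_iff_two_dvd.mpr h2)

/-- `DominoShadow` is false as typed (odd boards have no tilings; repair: even side `2k`). -/
theorem not_dominoShadow : ¬ DominoShadow := by
  intro h
  obtain ⟨m₀, hm₀⟩ := h 0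
  obtain ⟨L, hL⟩ := hm₀ (2 * m₀ + 1) (by omega)
  simp [dominoPoints_eq_empty_of_odd ⟨m₀, rfl⟩] at hL

/-! ## 3. planar-transport-transfer: `GridDimerShadow` is trivially inhabited -/

/-- Verbatim from `SketchIdeator3.lean`. -/
def GridAdj {m : ℕ} (u v : Fin m × Fin m) : Prop :=
  (u.1 = v.1 ∧ ((u.2 : ℕ) + 1 = v.2 ∨ (v.2 : ℕ) + 1 = u.2)) ∨
  (u.2 = v.2 ∧ ((u.1 : ℕ) + 1 = v.1 ∨ (v.1 : ℕ) + 1 = u.1))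

/-- Verbatim from `SketchIdeator3.lean`. -/
def IsBlack {m : ℕ} (u : Fin m × Fin m) : Prop := ((u.1 : ℕ) + (u.2 : ℕ)) % 2 = 0

open Classical in
/-- Verbatim from `SketchIdeator3.lean`. -/
noncomputable def blackCost {m : ℕ} (w : Fin m × Fin m → Fin m × Fin m → ℝ × ℝ)
    (ρ : Equiv.Perm (Fin m × Fin m)) (t : ℝ) : ℝ :=
  ∑ u, if IsBlack u then (w u (ρ u)).1 + t * (w u (ρ u)).2 else 0

/-- Verbatim from `SketchIdeator3.lean`. -/
def GridDimerShadow : Prop :=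
  ∀ c : ℕ, ∃ k₀ : ℕ, ∀ k ≥ k₀,
    ∃ w : Fin (2 * k) × Fin (2 * k) → Fin (2 * k) × Fin (2 * k) → ℝ × ℝ, ∃ m : ℕ,
      2 ^ ((Nat.log 2 (2 * k) + c) ^ c) < m ∧
      ∃ ρs : Fin m → Equiv.Perm (Fin (2 * k) × Fin (2 * k)), ∃ ts : Fin m → ℝ,
        (∀ i u, GridAdj u (ρs i u)) ∧
        ∀ i (ρ : Equiv.Perm (Fin (2 * k) × Fin (2 * k))), (∀ u, GridAdj u (ρ u)) →
          (∃ u, IsBlack u ∧ ρ u ≠ ρs i u) → blackCost w (ρs i) (ts i) < blackCost w ρ (ts i)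

/-- Pair column `2j` with column `2j+1`. -/
def flipFin (k : ℕ) (b : Fin (2 * k)) : Fin (2 * k) :=
  ⟨if b.val % 2 = 0 then b.val + 1 else b.val - 1, by
    rcases b with ⟨b, hb⟩
    dsimp only
    split_ifs with h <;> omega⟩

theorem flipFin_val (k : ℕ) (b : Fin (2 * k)) :
    (flipFin k b).val = if b.val % 2 = 0 then b.val + 1 else b.val - 1 := rfl

theorem flipFin_flipFin (k : ℕ) (b : Fin (2 * k)) : flipFin k (flipFin k b) = b := by
  apply Fin.ext
  rw [flipFin_val, flipFin_val]
  split_ifs with h1 h2 h2 <;> omega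

/-- The horizontal brick tiling as a permutation of the `2k × 2k` board. -/
def brick (k : ℕ) : Equiv.Perm (Fin (2 * k) × Fin (2 * k)) :=
  Function.Involutive.toPerm (fun u => (u.1, flipFin k u.2))
    (fun u => Prod.ext rfl (flipFin_flipFin k u.2))

theorem brick_apply (k : ℕ) (u : Fin (2 * k) × Fin (2 * k)) : brick k u = (u.1, flipFin k u.2) := rfl

/-- `GridDimerShadow` holds for a silly reason: nothing forces the `ρs i` to be distinct. -/
theorem gridDimerShadow_trivial : GridDimerShadow := by
  intro c
  refine ⟨0, fun k _ => ?_⟩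
  refine ⟨fun u v => if v = brick k u then ((0 : ℝ), (0 : ℝ)) else ((1 : ℝ), (0 : ℝ)),
    2 ^ ((Nat.log 2 (2 * k) + c) ^ c) + 1, Nat.lt_succ_self _, fun _ => brick k, fun _ => 0, ?_, ?_⟩
  · intro i u
    left
    refine ⟨rfl, ?_⟩
    show (u.2 : ℕ) + 1 = (flipFin k u.2 : ℕ) ∨ (flipFin k u.2 : ℕ) + 1 = u.2
    rw [flipFin_val]
    split_ifs <;> omega
  · rintro i ρ - ⟨u, hub, hne⟩
    have hne' : ρ u ≠ brick k u := hne
    have h0 : blackCost (fun u v => if v = brick k u then ((0 : ℝ), (0 : ℝ)) else ((1 : ℝ), (0 : ℝ)))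
        (brick k) 0 = 0 := by
      unfold blackCost
      refine Finset.sum_eq_zero fun v _ => ?_
      split_ifs <;> simp_all
    have h1 : (1 : ℝ) ≤ blackCost
        (fun u v => if v = brick k u then ((0 : ℝ), (0 : ℝ)) else ((1 : ℝ), (0 : ℝ))) ρ 0 := by
      unfold blackCost
      refine le_trans ?_ (Finset.single_le_sum (fun v _ => ?_) (Finset.mem_univ u))
      · simp only [if_pos hub, if_neg hne']
        norm_num
      · by_cases hb : IsBlack v <;> by_cases hρ : ρ v = brick k v <;> simp [hb, hρ]
    show blackCost _ (brick k) 0 < blackCost _ ρ 0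
    linarith

end TriageR1K3

end
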